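import Literature.Analysis.Complex.ThricePuncturedSphereAutomorphisms
import Literature.IUT.HodgeTheaters.ThetaHodgeTheatersRemarksA2
import Literature.AnabelianGeometry.AbsoluteAnabelian.AutHolomorphicSpacesLocalProofs
import Literature.AnabelianGeometry.AbsoluteAnabelian.CoorientationsProofs
import Literature.AnabelianGeometry.AbsoluteAnabelian.AutHolomorphicSpacesHolTypeProofs
import Literature.AnabelianGeometry.AbsoluteAnabelian.RCHolomorphicInverse
import Literature.AnabelianGeometry.AbsoluteAnabelian.AbsTopIII.RemarksArchimedeanLocalProofs
import Literature.AnabelianGeometry.AbsoluteAnabelian.ArchimedeanHolFieldFunctorGeometricRC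
import Mathlib.Analysis.Normed.Module.Connected
import Mathlib.LinearAlgebra.Complex.FiniteDimensional
import HarnessLib

/-!
# [IUTchI] Rmk 3.4.3 (ii): the REPAIRED reading C′ HOLDS at the genuine model (kernel theorem)

S. Mochizuki, *Inter-universal Teichmüller theory I*, §3, Remark 3.4.3 (ii), kurims p. 83: "the set of
NF-points … may be reconstructed via a functorial algorithm from the [abstract] Aut-holomorphic space
`D_v`" [cite: Mochizuki2012, Rmk 3.4.3 (ii) p.83] [claim: Mochizuki2012, status: disputed].

Companion of `AutHolSpaceNFFunctorialityNegative.lean` (finding F-L6t15g4-1, seat abc-iut-L6-t15 gen 4):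
there the cell's typed reading `NFPointsFunctorial` — functoriality under homeomorphisms normalising the
GLOBAL group `Aut^hol` — was refuted at the genuine model `P¹_ℚ ∖ {0,1,∞}`.  Here we prove that the
REPAIRED reading C′ — functoriality under isomorphisms of the FULL Aut-holomorphic structure
`W ↦ Aut^hol(W)` on all connected opens ([AbsTopIII] Def. 2.1 (i)(ii); abc-iut-L4's
`AutHolStructure.ofCharted` / `IsMorphism`) — HOLDS at that model, unconditionally:

* `S3RemarksLocal.AutHolSpaceNF.image_nfPoints_eq_of_isMorphism_model` — for `U = ℂ ∖ {0,1}` and any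
  self-homeomorphism `α` of `U` that is a morphism of the Aut-holomorphic space of the Riemann surface `U`
  to itself, `α '' (ℚ̄-points) = ℚ̄-points`.

Proof: by [AbsTopIII] Cor. 2.3 (i) — NOW A KERNEL THEOREM, abc-iut-L4's
`localMorphismIsRCHolomorphic_holds` — `α` is RC-holomorphic, hence (`U` being connected) holomorphic or
anti-holomorphic; in the first case `α ∈ Aut^hol(U) = S₃` (`ThricePunctured.eq_one_of_six`) is one of
the six rational Möbius maps, in the second `conj ∘ α` is; both kinds preserve `ℚ̄`-points.  So print's
claim, read with print's notion of isomorphism, is TRUE here — the defect found is in the typing only.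
No definition is declared; nothing here takes a side on [IUTchIII] Cor. 3.12.
-/

noncomputable section

namespace Literature.IUT.HodgeTheaters

open _root_.TopologicalSpace (Opens)
open _root_.Set
open scoped _root_.Manifold _root_.ContDiff ComplexConjugate
open Literature.AnabelianGeometry.AbsoluteAnabelian Literature.Analysis.Complex
open Literature.Analysis.Complex.ThricePunctured

/-- Every biholomorphic automorphism of `ℂ ∖ {0,1}` preserves `ℚ`-algebraic points (it is one of the six
rational Möbius maps, `ThricePunctured.eq_one_of_six`). [cite: Mochizuki2012, Rmk 3.4.3 (ii) p.83] -/
theorem AutHolSpaceNFWitness.isAlgebraic_apply_of_mem_holAut {U : Opens ℂ}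
    (hU : (U : Set ℂ) = {z | z ≠ 0 ∧ z ≠ 1}) {φ : U ≃ₜ U} (hφ : φ ∈ holAut U) {x : U}
    (hx : IsAlgebraic ℚ (x : ℂ)) : IsAlgebraic ℚ ((φ x : U) : ℂ) := by
  have h1 : IsAlgebraic ℚ (1 : ℂ) := isAlgebraic_one
  rcases eq_one_of_six hU hφ with h | h | h | h | h | h <;> rw [h x]
  · exact hx
  · exact h1.sub hx
  · exact hx.inv
  · exact (h1.sub hx).inv
  · exact h1.sub hx.inv
  · exact h1.sub (h1.sub hx).inv

/-- **[IUTchI] Rmk 3.4.3 (ii), REPAIRED READING C′, at the genuine model `P¹_ℚ ∖ {0,1,∞}`.**  Let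
`U = ℂ ∖ {0,1}` with its Riemann-surface structure.  Every self-homeomorphism `α` of `U` which is a
morphism of Aut-holomorphic spaces in the sense of [AbsTopIII] Def. 2.1 (ii) (abc-iut-L4 `IsMorphism` of
`AutHolStructure.ofCharted U`: it transports `Aut^hol(W)` for EVERY connected open `W`) carries the
NF-points (`ℚ̄`-points) onto the NF-points.  Unconditional: uses abc-iut-L4's kernel proof of
[AbsTopIII] Cor. 2.3 (i) (`localMorphismIsRCHolomorphic_holds`) and `Aut^hol(U) = S₃`
(`ThricePunctured.eq_one_of_six`). [cite: Mochizuki2012, Rmk 3.4.3 (ii) p.83] -/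
theorem S3RemarksLocal.AutHolSpaceNF.image_nfPoints_eq_of_isMorphism_model :
    let U : Opens ℂ := ⟨{z : ℂ | z ≠ 0 ∧ z ≠ 1}, isOpen_ne.inter isOpen_ne⟩
    ∀ α : U ≃ₜ U, IsMorphism (AutHolStructure.ofCharted U) (AutHolStructure.ofCharted U) α →
      α '' {x : U | IsAlgebraic ℚ (x : ℂ)} = {x : U | IsAlgebraic ℚ (x : ℂ)} := by
  intro U α hα
  have hU : (U : Set ℂ) = {z | z ≠ 0 ∧ z ≠ 1} := rfl
  -- Cor. 2.3 (i): `α` and `α⁻¹` are RC-holomorphic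
  have hrc : IsRCHolomorphic (⇑α) := IsMorphism.isRCHolomorphic_of localMorphismIsRCHolomorphic_holds hα
  have hrc' : IsRCHolomorphic (⇑α.symm) := hrc.symm_homeomorph
  -- `U` is connected
  have hpre : IsPreconnected (univ : Set U) := by
    have hfin : ({0, 1} : Set ℂ).Finite := by simp
    have hpc : IsPreconnected (({0, 1} : Set ℂ)ᶜ) :=
      (hfin.countable.isPathConnected_compl_of_one_lt_rank
        (by rw [Complex.rank_real_complex]; exact Nat.one_lt_ofNat)).isConnected.isPreconnected
    have hUc : (U : Set ℂ) = ({0, 1} : Set ℂ)ᶜ := by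
      rw [hU]; ext z; simp [not_or]
    have : IsPreconnected (U : Set ℂ) := hUc ▸ hpc
    haveI : PreconnectedSpace U := isPreconnected_iff_preconnectedSpace.mp this
    exact isPreconnected_univ
  -- complex conjugation on `U`, an ANTI-holomorphic involution
  have hcmem : ∀ z ∈ U, conj z ∈ U := fun z hz => by
    have hz' := (mem_iff hU).mp hz
    exact (mem_iff hU).mpr ⟨fun h => hz'.1 (by simpa using congrArg conj h),
      fun h => hz'.2 (by simpa using congrArg conj h)⟩
  have hcc : Continuous fun x : U => (⟨conj (x : ℂ), hcmem x x.2⟩ : U) :=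
    (Complex.continuous_conj.comp continuous_subtype_val).subtype_mk _
  let c : U ≃ₜ U :=
    { toFun := fun x => ⟨conj (x : ℂ), hcmem x x.2⟩
      invFun := fun x => ⟨conj (x : ℂ), hcmem x x.2⟩
      left_inv := fun x => Subtype.ext (by simp)
      right_inv := fun x => Subtype.ext (by simp)
      continuous_toFun := hcc
      continuous_invFun := hcc }
  have hcx : ∀ x : U, ((c x : U) : ℂ) = conj (x : ℂ) := fun _ => rfl
  have hcanti : ∀ x : U, IsAntiHolAt (⇑c) x := fun x =>
    IsAntiHolAt.restrict_opens (φ := fun w : ℂ => conj w) (e := ⇑c) hcx (HolRS.isAntiHolAt_conj _)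
  have hcanti' : ∀ x : U, IsAntiHolAt (⇑c.symm) x := fun x => hcanti x
  -- algebraicity is preserved by `Aut^hol(U)` and by `conj`
  have halg : ∀ {φ : U ≃ₜ U}, φ ∈ holAut U → ∀ {x : U}, IsAlgebraic ℚ (x : ℂ) →
      IsAlgebraic ℚ ((φ x : U) : ℂ) := fun hφ _ hx =>
    AutHolSpaceNFWitness.isAlgebraic_apply_of_mem_holAut hU hφ hx
  have hconj : ∀ {z : ℂ}, IsAlgebraic ℚ z → IsAlgebraic ℚ (conj z) := fun hz => by
    simpa using hz.algHom ((Complex.conjAe.restrictScalars ℚ).toAlgHom)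
  rcases forall_isHolAt_or_forall_isAntiHolAt α hrc hpre with hhol | hanti
  · -- `α` holomorphic everywhere: `α ∈ Aut^hol(U)`
    have hα : α ∈ holAut U := by
      refine (mem_holAut_iff α).mpr ⟨fun p => (hhol p (mem_univ p)).mdifferentiableAt, fun q => ?_⟩
      have h := isHolAt_symm_of_isHolAt α (hhol (α.symm q) (mem_univ _)) (hrc' (α (α.symm q)))
      rw [α.apply_symm_apply] at h
      exact h.mdifferentiableAt
    have hα' : α.symm ∈ holAut U := (holAut U).inv_mem hα
    ext y
    constructor
    · rintro ⟨x, hx, rfl⟩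
      exact halg hα hx
    · intro hy
      exact ⟨α.symm y, halg hα' hy, α.apply_symm_apply y⟩
  · -- `α` anti-holomorphic everywhere: `conj ∘ α ∈ Aut^hol(U)`
    have hαs : ∀ y : U, IsAntiHolAt (⇑α.symm) y := fun y => by
      have h := (hanti (α.symm y) (mem_univ _)).symm_apply α
      rwa [α.apply_symm_apply] at h
    have hψ : c * α ∈ holAut U := by
      refine (mem_holAut_iff (c * α)).mpr ⟨fun p => ?_, fun q => ?_⟩
      · exact (IsAntiHolAt.comp_isAntiHolAt (hcanti (α p)) (hanti p (mem_univ p))).mdifferentiableAt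
      · exact (IsAntiHolAt.comp_isAntiHolAt (g := ⇑α.symm) (f := ⇑c.symm)
          (hαs (c.symm q)) (hcanti' q)).mdifferentiableAt
    have hψ' : (c * α).symm ∈ holAut U := (holAut U).inv_mem hψ
    have e1 : ∀ x : U, ((α x : U) : ℂ) = conj (((c * α) x : U) : ℂ) := fun x => by
      rw [Homeomorph.mul_apply, hcx, Complex.conj_conj]
    have e2 : ∀ y : U, α.symm y = (c * α).symm (c y) := fun y => by
      rw [Homeomorph.symm_apply_eq]
      have h : (c * α) ((c * α).symm (c y)) = c y := (c * α).apply_symm_apply (c y)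
      rw [Homeomorph.mul_apply] at h
      exact (c.injective h).symm
    ext y
    constructor
    · rintro ⟨x, hx, rfl⟩
      change IsAlgebraic ℚ ((α x : U) : ℂ)
      rw [e1 x]
      exact hconj (halg hψ hx)
    · intro hy
      refine ⟨α.symm y, ?_, α.apply_symm_apply y⟩
      change IsAlgebraic ℚ ((α.symm y : U) : ℂ)
      rw [e2 y]
      exact halg hψ' (x := c y) (hconj hy)

end Literature.IUT.HodgeTheaters

end
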